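import Mathlib
import Summits.ValiantsHypothesis.ValiantsHypothesis.Theses.RigidityForcesSymmetry
import Summits.ValiantsHypothesis.ValiantsHypothesis.Theorems.RigidityForcesSymmetryRigidMinimalReprStubSliceOpen
import Summits.ValiantsHypothesis.ValiantsHypothesis.Theorems.RigidityForcesSymmetryRankInfRigidToLocallyOpenLocInj

/-!
# Support item `RigidityForcesSymmetry.RankInfRigidToLocallyOpen` (stmt-ValiantsHypothesis-24282) — PROOF
# (sub-crux A2 of crux `RankRigidMinimalRepr`, stmt-18034: the rank-constrained slice lemma)

Route `ValiantsHypothesis/RigidityForcesSymmetry`.  **Statement (the route decl, verbatim).**  For a finite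
variable type `ι`, `f ≠ 0` in `ℂ[x_ι]` and a pencil `x₀ = (Λ, A)` of size `m` with `det x̃₀ = f`
(`x̃₀ = Λ + Σ_v x_v A_v`): if every direction `(Λ', A')` that is Zariski-tangent to `{det = f}`
(`tr(adj x̃₀ · x̃') = 0`) AND rank-tangent at every slice (`A'_v · ker A_v ⊆ im A_v`) is a gauge direction
`(PΛ − ΛQ, (PA_v − A_vQ)_v)`, then on a neighbourhood of `(Λ, A)` every pencil with `det = f` and
`rank A'_v ≤ rank A_v` for all `v` is gauge-equivalent, `(gΛh⁻¹, (gA_vh⁻¹)_v)` with `g, h ∈ GL_m(ℂ)`.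

**Proof (slice argument inside the rank stratum).**  Choose a linear complement `W` of the gauge tangent
space `T = {(PΛ + ΛQ, (PA_v + A_vQ)_v)}` (`Submodule.exists_isCompl`).
* `stub_sliceOpen` (tree; inverse function theorem): every `p` near `x₀` is
  `((1+P)(Λ+w₁)(1+Q), ((1+P)(A_v+w₂ᵥ)(1+Q))_v)` with `(P, Q, w)` in any prescribed neighbourhood of `0`, `w ∈ W`.
* `rank_pencilLocInj` (companion file `…LocInj`; Jacobi + the Schur-type maps of `…RankChart` + injective
  differential): for `(c, w)` near `(1, 0)` with `w ∈ W`, `det((x₀ + w)~) = c·f` and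
  `rank (A_v + w_v) ≤ rank A_v ∀ v` force `w = 0`.
Since `1 + P`, `1 + Q` are invertible near `0`, `det p̃ = det(1+P)·det((x₀+w)~)·det(1+Q)`
(`map_C_mul_pencil_mul_map_C`) and `rank ((1+P) B (1+Q)) = rank B`
(`Matrix.rank_mul_eq_left/right_of_isUnit_det`), the two conditions on `p` transfer to `x₀ + w`, so `w = 0`
and `p = (gΛh⁻¹, (gA_vh⁻¹)_v)` with `g = 1 + P`, `h = (1 + Q)⁻¹`.  (The assembly is the tree's
`infRigidToLocallyOpen_of_slice` with the rank bookkeeping added.)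

Role: with A1 = `GrenetFirstOrderRankRigid` (stmt-21029, proved) this gives `TightRankRigid`
(`Cruxes/RankRigidMinimalRepr/CruxCalibration.lean`, `tightRankRigid_of_inf`) and hence the calibration
`crux_iff_target : RankRigidMinimalRepr ↔ GrenetLowerBound` given the proved support `RankRigidityForcesTorus`.
It does not move `ValiantsHypothesis` (VP ≠ VNP) itself.
-/

noncomputable section

set_option autoImplicit false

-- the mandated summit-side namespace repeats a component by design (single-problem summit)
set_option linter.dupNamespace false

namespace Summit.ValiantsHypothesis.ValiantsHypothesis.Theorems.RigidityForcesSymmetry.RankSlice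

open MvPolynomial Matrix Filter Topology
open Summit.ValiantsHypothesis.ValiantsHypothesis.Theorems.RigidityForcesSymmetryRigidMinimalRepr

/-- Constant two-sided multiplication acts on the coefficients of a pencil:
`P (Λ + Σ x_v A_v) Q = PΛQ + Σ x_v (P A_v Q)` (copy of the tree's `rft_map_C_mul_pencil_mul_map_C`, restated here
to keep this file out of the cone of `…RigidityForcesTorus`). -/
theorem map_C_mul_pencil_mul_map_C {ι : Type} [Fintype ι] {m : ℕ} (P Q Λ : Matrix (Fin m) (Fin m) ℂ)
    (A : ι → Matrix (Fin m) (Fin m) ℂ) :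
    (P.map C : Matrix (Fin m) (Fin m) (MvPolynomial ι ℂ)) *
        (Λ.map C + ∑ v, (X v : MvPolynomial ι ℂ) • (A v).map C) * Q.map C =
      (P * Λ * Q).map C + ∑ v, (X v : MvPolynomial ι ℂ) • (P * A v * Q).map C := by
  simp only [Matrix.mul_add, Matrix.add_mul, Finset.mul_sum, Finset.sum_mul, Matrix.mul_smul,
    Matrix.smul_mul, Matrix.map_mul]

/-- **Sub-crux A2 `RankInfRigidToLocallyOpen` (stmt-ValiantsHypothesis-24282) holds**: rank-infinitesimal
rigidity of a pencil point of `{det = f}`, `f ≠ 0`, implies that its `GL_m × GL_m`-orbit is open in the rank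
stratum of `{det = f}` near that point.  Slice argument: `stub_sliceOpen` + `rank_pencilLocInj`. -/
theorem RankInfRigidToLocallyOpen_proof :
    Summit.ValiantsHypothesis.ValiantsHypothesis.Theses.RigidityForcesSymmetry.RankInfRigidToLocallyOpen := by
  intro ι _ m f Λ A hf hdet hT
  classical
  -- the gauge tangent map `τ (P, Q) = (PΛ + ΛQ, (P A_v + A_v Q)_v)` and a linear complement `W` of its range
  let τ : (Matrix (Fin m) (Fin m) ℂ × Matrix (Fin m) (Fin m) ℂ) →ₗ[ℂ]
      (Matrix (Fin m) (Fin m) ℂ × (ι → Matrix (Fin m) (Fin m) ℂ)) :=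
    ((LinearMap.mulRight ℂ Λ).comp (LinearMap.fst ℂ _ _) +
        (LinearMap.mulLeft ℂ Λ).comp (LinearMap.snd ℂ _ _)).prod
      (LinearMap.pi fun v =>
        (LinearMap.mulRight ℂ (A v)).comp (LinearMap.fst ℂ _ _) +
          (LinearMap.mulLeft ℂ (A v)).comp (LinearMap.snd ℂ _ _))
  have hτ : ∀ P Q : Matrix (Fin m) (Fin m) ℂ,
      τ (P, Q) = (P * Λ + Λ * Q, fun v => P * A v + A v * Q) := fun P Q => rfl
  obtain ⟨W, hW⟩ := Submodule.exists_isCompl (LinearMap.range τ)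
  have hsup : ∀ x : Matrix (Fin m) (Fin m) ℂ × (ι → Matrix (Fin m) (Fin m) ℂ),
      ∃ (P Q : Matrix (Fin m) (Fin m) ℂ), ∃ w ∈ W,
        x = (P * Λ + Λ * Q, fun v => P * A v + A v * Q) + w := by
    intro x
    have hx : x ∈ LinearMap.range τ ⊔ W := by rw [hW.sup_eq_top]; trivial
    obtain ⟨t, ht, w, hw, rfl⟩ := Submodule.mem_sup.1 hx
    obtain ⟨⟨P, Q⟩, rfl⟩ := LinearMap.mem_range.1 ht
    exact ⟨P, Q, w, hw, by rw [hτ]⟩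
  have hinf : ∀ (P Q : Matrix (Fin m) (Fin m) ℂ), ∀ w ∈ W,
      ((P * Λ + Λ * Q, fun v => P * A v + A v * Q) :
          Matrix (Fin m) (Fin m) ℂ × (ι → Matrix (Fin m) (Fin m) ℂ)) = w → w = 0 := by
    intro P Q w hw h
    have ht : w ∈ LinearMap.range τ := LinearMap.mem_range.2 ⟨(P, Q), by rw [hτ, h]⟩
    have hbot : w ∈ LinearMap.range τ ⊓ W := Submodule.mem_inf.2 ⟨ht, hw⟩
    rw [hW.inf_eq_bot] at hbot
    simpa using hbot
  -- local injectivity on the slice inside the rank stratum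
  obtain ⟨N, hN, hJ'⟩ := rank_pencilLocInj ι m f Λ A W hf hdet hT hinf
  -- the parameter neighbourhood `V` of `0`
  let κ : (Matrix (Fin m) (Fin m) ℂ × Matrix (Fin m) (Fin m) ℂ) ×
        (Matrix (Fin m) (Fin m) ℂ × (ι → Matrix (Fin m) (Fin m) ℂ)) →
      ℂ × (Matrix (Fin m) (Fin m) ℂ × (ι → Matrix (Fin m) (Fin m) ℂ)) :=
    fun q => (((1 + q.1.1).det * (1 + q.1.2).det)⁻¹, q.2)
  have hc1 : Continuous fun q : (Matrix (Fin m) (Fin m) ℂ × Matrix (Fin m) (Fin m) ℂ) ×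
      (Matrix (Fin m) (Fin m) ℂ × (ι → Matrix (Fin m) (Fin m) ℂ)) => (1 + q.1.1).det :=
    (continuous_const.add (continuous_fst.comp continuous_fst)).matrix_det
  have hc2 : Continuous fun q : (Matrix (Fin m) (Fin m) ℂ × Matrix (Fin m) (Fin m) ℂ) ×
      (Matrix (Fin m) (Fin m) ℂ × (ι → Matrix (Fin m) (Fin m) ℂ)) => (1 + q.1.2).det :=
    (continuous_const.add (continuous_snd.comp continuous_fst)).matrix_det
  have hκ : ContinuousAt κ 0 := by
    refine ContinuousAt.prodMk ?_ continuous_snd.continuousAt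
    refine ((hc1.mul hc2).continuousAt).inv₀ ?_
    simp
  have hκ0 : κ 0 = (1, 0) := by simp [κ]
  have hV1 : κ ⁻¹' N ∈ 𝓝 (0 : (Matrix (Fin m) (Fin m) ℂ × Matrix (Fin m) (Fin m) ℂ) ×
      (Matrix (Fin m) (Fin m) ℂ × (ι → Matrix (Fin m) (Fin m) ℂ))) :=
    hκ.preimage_mem_nhds (by rw [hκ0]; exact hN)
  have hV2 : ∀ᶠ q in 𝓝 (0 : (Matrix (Fin m) (Fin m) ℂ × Matrix (Fin m) (Fin m) ℂ) ×
      (Matrix (Fin m) (Fin m) ℂ × (ι → Matrix (Fin m) (Fin m) ℂ))), (1 + q.1.1).det ≠ 0 :=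
    hc1.continuousAt.eventually_ne (by simp)
  have hV3 : ∀ᶠ q in 𝓝 (0 : (Matrix (Fin m) (Fin m) ℂ × Matrix (Fin m) (Fin m) ℂ) ×
      (Matrix (Fin m) (Fin m) ℂ × (ι → Matrix (Fin m) (Fin m) ℂ))), (1 + q.1.2).det ≠ 0 :=
    hc2.continuousAt.eventually_ne (by simp)
  -- the orbit–slice chart
  obtain ⟨U, hU, hU'⟩ := stub_sliceOpen ι m Λ A W hsup _ (inter_mem hV1 (hV2.and hV3))
  refine ⟨U, hU, fun p hp hpdet hprank => ?_⟩
  obtain ⟨q, ⟨hq1, hq2, hq3⟩, hqW, rfl⟩ := hU' p hp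
  -- `det p̃ = det(1+P) · det((x₀+w)~) · det(1+Q)`
  have hpencil := map_C_mul_pencil_mul_map_C (1 + q.1.1) (1 + q.1.2) (Λ + q.2.1) (fun v => A v + q.2.2 v)
  dsimp only at hpdet
  rw [← hpencil, det_mul, det_mul] at hpdet
  have hmapdet : ∀ N : Matrix (Fin m) (Fin m) ℂ,
      (N.map (C : ℂ →+* MvPolynomial ι ℂ)).det = (C N.det : MvPolynomial ι ℂ) := fun N => by
    rw [← RingHom.mapMatrix_apply, ← RingHom.map_det]
  rw [hmapdet, hmapdet] at hpdet
  have hab : (1 + q.1.1).det * (1 + q.1.2).det ≠ 0 := mul_ne_zero hq2 hq3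
  have key : ((Λ + (κ q).2.1).map MvPolynomial.C +
        ∑ v, (MvPolynomial.X v : MvPolynomial ι ℂ) • (A v + (κ q).2.2 v).map MvPolynomial.C).det
      = MvPolynomial.C (κ q).1 * f := by
    show ((Λ + q.2.1).map C + ∑ v, (X v : MvPolynomial ι ℂ) • (A v + q.2.2 v).map C).det
      = C ((1 + q.1.1).det * (1 + q.1.2).det)⁻¹ * f
    rw [← hpdet]
    set D : MvPolynomial ι ℂ :=
      ((Λ + q.2.1).map C + ∑ v, (X v : MvPolynomial ι ℂ) • (A v + q.2.2 v).map C).det with hD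
    calc D = C (((1 + q.1.1).det * (1 + q.1.2).det)⁻¹ * ((1 + q.1.1).det * (1 + q.1.2).det)) * D := by
          rw [inv_mul_cancel₀ hab, C_1, one_mul]
      _ = C ((1 + q.1.1).det * (1 + q.1.2).det)⁻¹ * (C (1 + q.1.1).det * D * C (1 + q.1.2).det) := by
          rw [C_mul, C_mul]; ring
  -- `rank ((1+P) B (1+Q)) = rank B`: the rank constraint transfers to the slice point `x₀ + w`
  have hrank : ∀ v, (A v + (κ q).2.2 v).rank ≤ (A v).rank := by
    intro v
    have h := hprank v
    dsimp only at h
    rwa [Matrix.rank_mul_eq_left_of_isUnit_det _ _ (isUnit_iff_ne_zero.2 hq3),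
      Matrix.rank_mul_eq_right_of_isUnit_det _ _ (isUnit_iff_ne_zero.2 hq2)] at h
  have hw0 : q.2 = 0 := hJ' (κ q) hq1 hqW key hrank
  refine ⟨Matrix.GeneralLinearGroup.mkOfDetNeZero _ hq2,
    (Matrix.GeneralLinearGroup.mkOfDetNeZero _ hq3)⁻¹, ?_, fun v => ?_⟩
  · simp [hw0, Matrix.GeneralLinearGroup.mkOfDetNeZero]
  · simp [hw0, Matrix.GeneralLinearGroup.mkOfDetNeZero]

end Summit.ValiantsHypothesis.ValiantsHypothesis.Theorems.RigidityForcesSymmetry.RankSlice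

end
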